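import Mathlib
import Summits.Ventures.HodgeRepro.PeriodCloserC7Stability
import Summits.Ventures.HodgeRepro.OcticCMPointS3

/-!
# OcticCMPointTameModel — conductor `1` at the ramified places `𝔭₁, 𝔭₂ | 5`: the quadratic character's root number

Blind re-derivation cell `pub-hodge-repro`, seat night-2 (gen 4).  Target tree path
`lean/Summits/Ventures/HodgeRepro/OcticCMPointTameModel.lean`.  The conductor-`1` companion of
`OcticCMPointDualModel.lean` (`c = 2`) and `OcticCMPointTruncModel.lean` (`2 ≤ c ≤ 4`): the model ring is the
residue field `𝔽₅ = ZMod 5` itself, the conjugation `σ` is the IDENTITY on the residue field (the place is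
totally ramified in `K_v/k_v`), and gen 3's `OcticCMPointTameSign.lean` works on a general field of `5`
elements with `ψ` and `ConjDual` as hypotheses.  Here, on `𝔽₅` with any primitive `ψ₀`:

* `conjDual_iff_sq`: conjugate duality `ω ∘ σ = ω⁻¹` with `σ = id` means `ω² = 1` on `𝔽₅^×` — the only
  characters are the trivial one and the quadratic character `χ_quad`;
* `gaussSum_quad_sq_five`: `𝔤(χ_quad, ψ₀)² = χ_quad(−1) · 5 = 5` (Mathlib `gaussSum_sq`; `−1` is a square mod `5`),
  so `𝔤(χ_quad, ψ₀) = ±√5` (`gaussSum_quad_eq_sqrt_or_neg`);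
* **`eps_quad_tame`**: Kudla's `ε(s, ω, ψ)` on the model for `ω = ⟨χ_quad, ω(ϖ)⟩` at `s = ½` (`κ = 5^{−1/2}`) is
  `± ω(ϖ)^n` — the conductor-`1` local root number at `𝔭₁, 𝔭₂ | 5` in closed form (the sign is Gauss's, not
  derived); `eps_quad_tame_sign`: `±1` when `ω(ϖ)² = 1` (conjugate-orthogonal) — and for the conjugate-symplectic
  case `ω(ϖ)² = ω(−1) = χ_quad(−1) = 1` as well.

**What this is not.**  The sign of the quadratic Gauss sum (Gauss's theorem) is not in Mathlib and not derived;
nothing here says anything about the status of the Hodge conjecture for CM abelian varieties, which is NOT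
proved.
-/

set_option autoImplicit false

noncomputable section

open Finset

namespace Summit.Ventures.HodgeRepro.PeriodCloser

namespace TameModel

/-- `5` is prime. -/
instance fact_prime_five : Fact (Nat.Prime 5) := ⟨by norm_num⟩

/-- The quadratic character of `𝔽₅` with complex values. -/
def quadChar5 : MulChar (ZMod 5) ℂ := (quadraticChar (ZMod 5)).ringHomComp (Int.castRingHom ℂ)

/-- **Conjugate duality at a totally ramified place, conductor `1`**: the conjugation is the identity on the
residue field, so `ω ∘ σ = ω⁻¹` means `ω(a) = ω(a)⁻¹`, i.e. `ω(a)² = 1` for `a ≠ 0`. -/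
theorem conjDual_iff_sq (ω : MulChar (ZMod 5) ℂ) :
    (∀ a, ω a = ω⁻¹ a) ↔ ∀ a : ZMod 5, a ≠ 0 → ω a ^ 2 = 1 := by
  constructor
  · intro h a ha
    have h1 := h a
    rw [MulChar.inv_apply_eq_inv'] at h1
    have hne : ω a ≠ 0 := by
      intro h0
      have h2 : ω a * ω a⁻¹ = 1 := by rw [← map_mul, mul_inv_cancel₀ ha, MulChar.map_one]
      rw [h0, zero_mul] at h2
      exact zero_ne_one h2
    rw [sq]
    calc ω a * ω a = ω a * (ω a)⁻¹ := by rw [← h1]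
      _ = 1 := mul_inv_cancel₀ hne
  · intro h a
    rw [MulChar.inv_apply_eq_inv']
    by_cases ha : a = 0
    · subst ha; rw [MulChar.map_zero, inv_zero]
    · have h2 := h a ha
      rw [sq] at h2
      exact eq_inv_of_mul_eq_one_left h2

/-- `χ_quad` is conjugate-dual (`χ_quad² = 1`). -/
theorem quadChar5_conjDual : ∀ a, quadChar5 a = quadChar5⁻¹ a := by
  rw [conjDual_iff_sq]
  intro a ha
  rw [quadChar5, MulChar.ringHomComp_apply, eq_intCast, ← Int.cast_pow, quadraticChar_sq_one ha, Int.cast_one]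

/-- `χ_quad ≠ 1` and it is quadratic. -/
theorem quadChar5_ne_one : quadChar5 ≠ 1 :=
  (MulChar.ringHomComp_ne_one_iff Int.cast_injective).2 (quadraticChar_ne_one (by
    rw [ZMod.ringChar_zmod_n]; norm_num))

/-- `χ_quad` is quadratic. -/
theorem quadChar5_isQuadratic : quadChar5.IsQuadratic := (quadraticChar_isQuadratic (ZMod 5)).comp _

/-- `χ_quad(−1) = 1`: `−1 = 4 = 2²` in `𝔽₅`. -/
theorem quadChar5_neg_one : quadChar5 (-1) = 1 := by
  rw [quadChar5, MulChar.ringHomComp_apply, eq_intCast]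
  have : quadraticChar (ZMod 5) (-1) = 1 := by decide
  rw [this, Int.cast_one]

/-- **`𝔤(χ_quad, ψ₀)² = 5`** for a primitive `ψ₀` (Mathlib `gaussSum_sq`). -/
theorem gaussSum_quad_sq_five (ψ₀ : AddChar (ZMod 5) ℂ) (h₀ : ψ₀.IsPrimitive) :
    gaussSum quadChar5 ψ₀ ^ 2 = 5 := by
  rw [gaussSum_sq quadChar5_ne_one quadChar5_isQuadratic h₀, quadChar5_neg_one, one_mul, ZMod.card]
  norm_num

/-- **`𝔤(χ_quad, ψ₀) = ±√5`.** -/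
theorem gaussSum_quad_eq_sqrt_or_neg (ψ₀ : AddChar (ZMod 5) ℂ) (h₀ : ψ₀.IsPrimitive) :
    gaussSum quadChar5 ψ₀ = ((Real.sqrt 5 : ℝ) : ℂ) ∨ gaussSum quadChar5 ψ₀ = -((Real.sqrt 5 : ℝ) : ℂ) := by
  have h : gaussSum quadChar5 ψ₀ ^ 2 = ((Real.sqrt 5 : ℝ) : ℂ) ^ 2 := by
    rw [gaussSum_quad_sq_five ψ₀ h₀, ← Complex.ofReal_pow, Real.sq_sqrt (by norm_num)]
    norm_num
  exact sq_eq_sq_iff_eq_or_eq_neg.1 h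

/-- `χ_quad⁻¹ = χ_quad`. -/
theorem quadChar5_inv : quadChar5⁻¹ = quadChar5 := quadChar5_isQuadratic.inv

/-- **The conductor-`1` root number of the quadratic character at `𝔭₁, 𝔭₂ | 5`**: for `ω = ⟨χ_quad, ω(ϖ)⟩`,
`ψ₀` primitive and `κ = 5^{−1/2}` (the `s = ½` constant `|R|^{−1/2}`, `|𝔽₅| = 5`),
`ε(½, ω, ψ₀) = ω(ϖ)^n · κ · 𝔤(χ_quad⁻¹, ψ₀) = ± ω(ϖ)^n`. -/
theorem eps_quad_tame (ψ₀ : AddChar (ZMod 5) ℂ) (h₀ : ψ₀.IsPrimitive) (n : ℕ) (π : ℂ) :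
    LocalChar.eps (((Real.sqrt 5)⁻¹ : ℝ) : ℂ) n (⟨quadChar5, π⟩ : LocalChar (ZMod 5)) ψ₀ = π ^ n ∨
      LocalChar.eps (((Real.sqrt 5)⁻¹ : ℝ) : ℂ) n (⟨quadChar5, π⟩ : LocalChar (ZMod 5)) ψ₀ = -π ^ n := by
  unfold LocalChar.eps LocalChar.gauss
  change π ^ n * _ * gaussSum quadChar5⁻¹ ψ₀ = _ ∨ π ^ n * _ * gaussSum quadChar5⁻¹ ψ₀ = _
  rw [quadChar5_inv]
  have hs : ((Real.sqrt 5 : ℝ) : ℂ) ≠ 0 := by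
    rw [Complex.ofReal_ne_zero]
    exact (Real.sqrt_pos.2 (by norm_num)).ne'
  rcases gaussSum_quad_eq_sqrt_or_neg ψ₀ h₀ with h | h
  · left
    rw [h, Complex.ofReal_inv, mul_assoc, inv_mul_cancel₀ hs, mul_one]
  · right
    rw [h, Complex.ofReal_inv, mul_neg, mul_assoc, inv_mul_cancel₀ hs, mul_one]

/-- **The conductor-`1` sign at `𝔭₁, 𝔭₂ | 5`**: with `ω(ϖ)² = 1` the root number is `±1`. -/
theorem eps_quad_tame_sign (ψ₀ : AddChar (ZMod 5) ℂ) (h₀ : ψ₀.IsPrimitive) (n : ℕ) (π : ℂ) (hπ : π ^ 2 = 1) :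
    LocalChar.eps (((Real.sqrt 5)⁻¹ : ℝ) : ℂ) n (⟨quadChar5, π⟩ : LocalChar (ZMod 5)) ψ₀ = 1 ∨
      LocalChar.eps (((Real.sqrt 5)⁻¹ : ℝ) : ℂ) n (⟨quadChar5, π⟩ : LocalChar (ZMod 5)) ψ₀ = -1 := by
  have h1 : π * π = 1 := by rw [← sq]; exact hπ
  rcases eps_quad_tame ψ₀ h₀ n π with h | h <;> rw [h] <;>
    rcases mul_self_eq_one_iff.1 h1 with h2 | h2 <;> rw [h2]
  · left; rw [one_pow]
  · exact neg_one_pow_eq_or ℂ n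
  · right; rw [one_pow]
  · rcases neg_one_pow_eq_or ℂ n with h3 | h3
    · right; rw [h3]
    · left; rw [h3, neg_neg]

/-- The residue cardinality at `𝔭₁ | 5` is `5` and `κ² · 5 = 1` for `κ = 5^{−1/2}` — the `HalfNormalised`
hypothesis of gen 3's `OcticCMPointTameSign.lean` in numbers (`card_p1`, `octic_p1.qK = 5`). -/
theorem kappa_sq_mul_five : ((((Real.sqrt 5)⁻¹ : ℝ) : ℂ)) ^ 2 * (octic_p1.qK : ℂ) = 1 := by
  have : (octic_p1.qK : ℂ) = 5 := by rfl
  rw [this, ← Complex.ofReal_pow, inv_pow, Real.sq_sqrt (by norm_num)]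
  norm_num

/-- **(E3) at `𝔭₁, 𝔭₂ | 5` at conductor `1` from N2**: the only non-trivial conjugate-dual tame character is
`χ_quad`, so four such lines `⟨χ_quad, π_j⟩` have `ε_j = π_j^n · κ · 𝔤(χ_quad, ψ₀)` with a COMMON Gauss sum, and
`ε₀ε₁ = ε₂ε₃` follows from the `ϖ`-part of N2, `π₀π₁ = π₂π₃`. -/
theorem E3_tame_of_N2 (ψ₀ : AddChar (ZMod 5) ℂ) (κ : ℂ) (n : ℕ) (π : Fin 4 → ℂ) (hN2 : π 0 * π 1 = π 2 * π 3) :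
    LocalChar.eps κ n (⟨quadChar5, π 0⟩ : LocalChar (ZMod 5)) ψ₀ *
        LocalChar.eps κ n (⟨quadChar5, π 1⟩ : LocalChar (ZMod 5)) ψ₀ =
      LocalChar.eps κ n (⟨quadChar5, π 2⟩ : LocalChar (ZMod 5)) ψ₀ *
        LocalChar.eps κ n (⟨quadChar5, π 3⟩ : LocalChar (ZMod 5)) ψ₀ := by
  have hval : ∀ j, LocalChar.eps κ n (⟨quadChar5, π j⟩ : LocalChar (ZMod 5)) ψ₀ =
      π j ^ n * (κ * gaussSum quadChar5 ψ₀) := by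
    intro j
    unfold LocalChar.eps LocalChar.gauss
    change π j ^ n * κ * gaussSum quadChar5⁻¹ ψ₀ = _
    rw [quadChar5_inv, mul_assoc]
  rw [hval 0, hval 1, hval 2, hval 3]
  calc π 0 ^ n * (κ * gaussSum quadChar5 ψ₀) * (π 1 ^ n * (κ * gaussSum quadChar5 ψ₀)) =
      (π 0 * π 1) ^ n * (κ * gaussSum quadChar5 ψ₀) ^ 2 := by ring
    _ = (π 2 * π 3) ^ n * (κ * gaussSum quadChar5 ψ₀) ^ 2 := by rw [hN2]
    _ = _ := by ring

/-- **(E2) at `𝔭₁, 𝔭₂ | 5` is solvable for either sign** (ROUTE-B §9.9 (c), the free choice of the line class):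
the norm-residue symbol of the ramified quadratic `K_v/k_v` on the Teichmüller units is `χ_quad` (standard local
class field theory for `q` odd — not on a held page), which takes both values, `χ_quad(1) = 1` and
`χ_quad(2) = −1`; so for every sign `s` there is a unit class `a` with `ω_v(a) = s`. -/
theorem E2_solvable (s : ℂ) (hs : s = 1 ∨ s = -1) : ∃ a : ZMod 5, a ≠ 0 ∧ quadChar5 a = s := by
  rcases hs with rfl | rfl
  · refine ⟨1, one_ne_zero, ?_⟩
    rw [quadChar5, MulChar.ringHomComp_apply, eq_intCast]
    have : quadraticChar (ZMod 5) 1 = 1 := by decide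
    rw [this, Int.cast_one]
  · refine ⟨2, by decide, ?_⟩
    rw [quadChar5, MulChar.ringHomComp_apply, eq_intCast]
    have : quadraticChar (ZMod 5) 2 = -1 := by decide
    rw [this, Int.cast_neg, Int.cast_one]

/-! ### Gauss's sign at `𝔽₅`: `𝔤(χ_quad, ψ₅) = +√5` for `ψ₅(x) = e(x/5)` -/

/-- `ζ₅ = e^{2πi/5}`. -/
def zeta5 : ℂ := Complex.exp (((2 * Real.pi / 5 : ℝ) : ℂ) * Complex.I)

/-- `ζ₅` is a primitive `5`-th root of unity. -/
theorem zeta5_isPrimitiveRoot : IsPrimitiveRoot zeta5 5 := by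
  have h := Complex.isPrimitiveRoot_exp 5 (by norm_num)
  convert h using 2
  rw [zeta5]
  congr 1
  push_cast
  ring

/-- `ζ₅⁵ = 1`. -/
theorem zeta5_pow_five : zeta5 ^ 5 = 1 := zeta5_isPrimitiveRoot.pow_eq_one

/-- **The standard additive character of `𝔽₅`**: `ψ₅(x) = ζ₅^x`. -/
def psi5 : AddChar (ZMod 5) ℂ := AddChar.zmodChar 5 zeta5_pow_five

/-- `ψ₅` is primitive. -/
theorem psi5_isPrimitive : psi5.IsPrimitive :=
  AddChar.zmodChar_primitive_of_primitive_root 5 zeta5_isPrimitiveRoot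

/-- `ψ₅(a) = ζ₅^{a.val}`. -/
theorem psi5_apply (a : ZMod 5) : psi5 a = zeta5 ^ a.val := rfl

/-- The Gauss sum expanded: `𝔤(χ_quad, ψ₅) = ζ + ζ⁴ − ζ² − ζ³` (`χ_quad = (0, 1, −1, −1, 1)` on `(0, 1, 2, 3, 4)`). -/
theorem gaussSum_quad_psi5_expand : gaussSum quadChar5 psi5 = zeta5 + zeta5 ^ 4 - zeta5 ^ 2 - zeta5 ^ 3 := by
  unfold gaussSum
  have hq : ∀ a : ZMod 5, quadChar5 a = ((quadraticChar (ZMod 5) a : ℤ) : ℂ) := fun a => by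
    rw [quadChar5, MulChar.ringHomComp_apply, eq_intCast]
  simp only [hq, psi5_apply]
  change ∑ i : Fin 5, (((quadraticChar (ZMod 5) i : ℤ) : ℂ) * zeta5 ^ (i : ZMod 5).val) = _
  rw [Fin.sum_univ_five]
  have h0 : quadraticChar (ZMod 5) ((0 : Fin 5) : ZMod 5) = 0 := by decide
  have h1 : quadraticChar (ZMod 5) ((1 : Fin 5) : ZMod 5) = 1 := by decide
  have h2 : quadraticChar (ZMod 5) ((2 : Fin 5) : ZMod 5) = -1 := by decide
  have h3 : quadraticChar (ZMod 5) ((3 : Fin 5) : ZMod 5) = -1 := by decide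
  have h4 : quadraticChar (ZMod 5) ((4 : Fin 5) : ZMod 5) = 1 := by decide
  rw [h0, h1, h2, h3, h4]
  have v1 : ((1 : Fin 5) : ZMod 5).val = 1 := by decide
  have v2 : ((2 : Fin 5) : ZMod 5).val = 2 := by decide
  have v3 : ((3 : Fin 5) : ZMod 5).val = 3 := by decide
  have v4 : ((4 : Fin 5) : ZMod 5).val = 4 := by decide
  rw [v1, v2, v3, v4]
  push_cast
  ring

/-- `conj ζ₅ = ζ₅⁻¹`. -/
theorem conj_zeta5 : (starRingEnd ℂ) zeta5 = zeta5⁻¹ := by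
  rw [zeta5, ← Complex.exp_conj, map_mul, Complex.conj_ofReal, Complex.conj_I, mul_neg, Complex.exp_neg]

/-- `ζ₅⁴ = ζ₅⁻¹` and `ζ₅³ = ζ₅⁻²`. -/
theorem zeta5_pow_four : zeta5 ^ 4 = zeta5⁻¹ := by
  have h : zeta5 ^ 4 * zeta5 = 1 := by rw [← pow_succ, zeta5_pow_five]
  exact eq_inv_of_mul_eq_one_left h

/-- `ζ₅³ = (ζ₅²)⁻¹`. -/
theorem zeta5_pow_three : zeta5 ^ 3 = (zeta5 ^ 2)⁻¹ := by
  have h : zeta5 ^ 3 * zeta5 ^ 2 = 1 := by rw [← pow_add, zeta5_pow_five]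
  exact eq_inv_of_mul_eq_one_left h

/-- `ζ₅ + ζ₅⁴ = 2 cos(2π/5)`. -/
theorem zeta5_add_pow_four : zeta5 + zeta5 ^ 4 = ((2 * Real.cos (2 * Real.pi / 5) : ℝ) : ℂ) := by
  rw [zeta5_pow_four, ← conj_zeta5, Complex.add_conj]
  congr 2
  rw [zeta5, Complex.exp_ofReal_mul_I_re]

/-- `conj (ζ₅²) = (ζ₅²)⁻¹`. -/
theorem conj_zeta5_sq : (starRingEnd ℂ) (zeta5 ^ 2) = (zeta5 ^ 2)⁻¹ := by
  rw [map_pow, conj_zeta5, inv_pow]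

/-- `ζ₅² + ζ₅³ = 2 cos(4π/5)`. -/
theorem zeta5_sq_add_cube : zeta5 ^ 2 + zeta5 ^ 3 = ((2 * Real.cos (2 * (2 * Real.pi / 5)) : ℝ) : ℂ) := by
  rw [zeta5_pow_three, ← conj_zeta5_sq, Complex.add_conj]
  congr 2
  have h : zeta5 ^ 2 = Complex.exp (((2 * (2 * Real.pi / 5) : ℝ) : ℂ) * Complex.I) := by
    rw [zeta5, ← Complex.exp_nat_mul]
    congr 1
    push_cast
    ring
  rw [h, Complex.exp_ofReal_mul_I_re]

/-- `cos(2π/5) = (√5 − 1)/4` (from Mathlib's `cos(π/5) = (1 + √5)/4`). -/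
theorem cos_two_pi_div_five : Real.cos (2 * Real.pi / 5) = (Real.sqrt 5 - 1) / 4 := by
  have h5 := Real.sq_sqrt (show (0 : ℝ) ≤ 5 by norm_num)
  rw [show 2 * Real.pi / 5 = 2 * (Real.pi / 5) by ring, Real.cos_two_mul, Real.cos_pi_div_five]
  linear_combination (1 / 8 : ℝ) * h5

/-- `cos(4π/5) = −(√5 + 1)/4`. -/
theorem cos_four_pi_div_five : Real.cos (2 * (2 * Real.pi / 5)) = -(Real.sqrt 5 + 1) / 4 := by
  have h5 := Real.sq_sqrt (show (0 : ℝ) ≤ 5 by norm_num)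
  rw [Real.cos_two_mul, cos_two_pi_div_five]
  linear_combination (1 / 8 : ℝ) * h5

/-- **Gauss's sign at `𝔽₅`**: `𝔤(χ_quad, ψ₅) = +√5` for the standard `ψ₅(x) = e(x/5)`
(`ζ + ζ⁴ − ζ² − ζ³ = 2cos(2π/5) − 2cos(4π/5) = √5`). -/
theorem gaussSum_quad_psi5 : gaussSum quadChar5 psi5 = ((Real.sqrt 5 : ℝ) : ℂ) := by
  rw [gaussSum_quad_psi5_expand,
    show zeta5 + zeta5 ^ 4 - zeta5 ^ 2 - zeta5 ^ 3 = (zeta5 + zeta5 ^ 4) - (zeta5 ^ 2 + zeta5 ^ 3) by ring,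
    zeta5_add_pow_four, zeta5_sq_add_cube, cos_two_pi_div_five, cos_four_pi_div_five]
  push_cast
  ring

/-- **The conductor-`1` root number of `χ_quad` at `𝔭₁, 𝔭₂ | 5` for the standard `ψ₅`, EXACTLY**:
`ε(½, ⟨χ_quad, ω(ϖ)⟩, ψ₅) = ω(ϖ)^n` (`κ = 5^{−1/2}`). -/
theorem eps_quad_psi5 (n : ℕ) (π : ℂ) :
    LocalChar.eps (((Real.sqrt 5)⁻¹ : ℝ) : ℂ) n (⟨quadChar5, π⟩ : LocalChar (ZMod 5)) psi5 = π ^ n := by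
  unfold LocalChar.eps LocalChar.gauss
  change π ^ n * _ * gaussSum quadChar5⁻¹ psi5 = _
  rw [quadChar5_inv, gaussSum_quad_psi5, Complex.ofReal_inv, mul_assoc, inv_mul_cancel₀ (by
    rw [Complex.ofReal_ne_zero]; exact (Real.sqrt_pos.2 (by norm_num)).ne'), mul_one]

/-- **The shifted Gauss sum `𝔤(χ_quad, ψ₅(·/2)) = −√5`** (`2⁻¹ = 3` in `𝔽₅`, `χ_quad(3) = −1`): the quadratic
Gauss sum of `OcticCMPointTruncThree.lean` for `ψ₀ = ψ₅`, so the conductor-`3` twist's root number there is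
`−ρ(ϖ)^n` for the standard `ψ₅`. -/
theorem gaussSum_quad_psi5_half :
    gaussSum quadChar5 (AddChar.mulShift psi5 (2 : ZMod 5)⁻¹) = -((Real.sqrt 5 : ℝ) : ℂ) := by
  have h3 : (2 : ZMod 5)⁻¹ = 3 := inv_eq_of_mul_eq_one_right (by decide)
  rw [h3]
  have hu : IsUnit (3 : ZMod 5) := isUnit_iff_ne_zero.2 (by decide)
  rw [show (3 : ZMod 5) = ((hu.unit : (ZMod 5)ˣ) : ZMod 5) from hu.unit_spec.symm, gaussSum_mulShift_eq,
    hu.unit_spec, quadChar5_inv, gaussSum_quad_psi5, quadChar5, MulChar.ringHomComp_apply, eq_intCast]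
  have : quadraticChar (ZMod 5) 3 = -1 := by decide
  rw [this, Int.cast_neg, Int.cast_one, neg_one_mul]

end TameModel

end Summit.Ventures.HodgeRepro.PeriodCloser

end
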